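import Summits.QuantumFields.BalabanUV.Beta.FP.MixLoopPowerCounting
import Summits.QuantumFields.BalabanUV.Beta.FP.HorizontalEndNat

/-!
# `BalabanUV.Beta.FP.HorizontalRemainderTotal` — road «FP» for binder row D1, row **GAMMA-8** (owner END «by type», organisation γ) — THE END OF RECORD
# (erratum E-FP-7-3 to `FP/HorizontalRemainder`): `hbook` from the truncated transport's TOTAL second moment (H3-BOOK (a)) and ONE remainder letter — a
# uniform bound on the FINITE weighted sums `Σ_{v∈S} ‖v‖∞²·|T μ ν v − Xtr v|` — which is EXACTLY the output currency of the mass-currency power counting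
# (`FP/MixLoopPowerCountingMass.coarse_mix2_secondMoment_le`); no coarse near∕far split, no tail matching, no `hgerm` at this stage

HONEST DEPENDENCY (page 1, mandatory): continuum YM on T⁴ ⇐ BetaPertH ∧ nine spine estimates (0/9 proved); BetaPertH ⇐ (D1) ∧ (D4) ∧ CAP+tail;
G-an2-4 gates asym, D1 and NE2/3/4.  HONEST FRAMING (cell contract, verbatim): «discharging `BetaPertH` makes Bałaban's UV stability UNCONDITIONAL — a real
constructive-QFT result; it is NOT the continuum limit and NOT the Clay problem.»  THIS MODULE is [folklore] bookkeeping of unconditional sums on `ℤ⁴` (Mathlib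
`summable_of_sum_le`, the tree's `DyadicShell` letters, `MixLoopPowerCounting.abs_coord_mul_coord_le`) and the END `FP/HorizontalEndNat.hasym_of_horizontal_nat` BY NAME; EVERY analytic input is a HYPOTHESIS with its
supplier row named; no `def`, no `def … : Prop`, nothing cited, 0 sorry.  NOT hbook-discharged, NOT hasym, NOT D1, NOT BetaPertH, NOT continuum, NOT Clay.

ABSOLUTE RULE (cell charter, verbatim): «No internally-minted statement may enter as a cited fact. Every hypothesis is either kernel-proved in this package or a
verbatim quotation of a PUBLISHED theorem with page reference. The manuscript(s) under audit are NOT citable for their own disputed steps — they are the thing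
under adjudication; programme-internal (2001/route/tribunal) claims are never citable.»

WHY THIS SUPERSEDES `FP/HorizontalRemainder` §1 AS THE END OF RECORD (owner erratum E-FP-7-3, gen 7).  `HorizontalRemainder.abs_secondMoment_sub_window_le_gamma`
is a correct theorem, but its letters (near: ENTRYWISE bounds on `‖v‖ ≤ R₀`; farT∕farX: n-free far annular second moments of `T` and of `Xtr` SEPARATELY) are NOT
instantiable n-free on the road: the transport weights (minimiser columns) are exponentially localised, not compactly supported, so the far coarse entries of BOTH
`T_n` and `Xtr` carry the window's `log N` times the weights' exponential tail — only their DIFFERENCE is log-free.  The remainder `T − Xtr = Jᵀ·r·J` is the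
J-contraction of the FINE remainder kernel `r = Π_n − K·𝟙[‖·‖ ≤ N]` (near-fine: the remainder loops of GAMMA-5∕6, MIX, ghost; far-fine: `Π_n` itself, RHOA-4), whose
fine letters carry no log; its coarse weighted sums are bounded DIRECTLY and n-free by the mass-currency engine, in exactly the currency (rem) below.  So the END needs
ONE letter on `T − Xtr`, over all `v` at once.

THE STATEMENT (`abs_secondMoment_sub_window_le_of_remainder`).  Channel `(μ, ν)`, window value `gN`:
(a)   `HasSum (v ↦ Xtr v·v_μ·v_ν) (gN + E₀)`, `|E₀| ≤ U₀`                      [H3-BOOK (a) ✓ `HorizontalBookkeeping.hasSum_coarse_secondMoment_truncK` — the TOTAL coarse second moment];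
(rem) `∀ S : Finset Pt, Σ_{v∈S} ‖v‖∞²·|T μ ν v − Xtr v| ≤ Bρ`                 [GAMMA-5∕6, RHOA-6c′ (`coarse_mix2_secondMoment_le` shape at `v₀ = 0`), RHOA-7, GAMMA-9 (GH-a), GAMMA-7, RHOA-4 far-fine].
CONCLUSION: `Summable (v ↦ T μ ν v·v_μ·v_ν)` and `|secondMoment T μ ν − gN| ≤ U₀ + Bρ`; §2 the m-uniform `hbook` and `hasym` BY NAME.
Provenance: road FP OWNER b2b-balaban-beta-d1-p3 gen 7 (prover-b2b-balaban-beta-d1-p3-g7-0), 2026-08-21, row GAMMA-8 (END of record); «not in print; our bookkeeping».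
-/

noncomputable section

namespace Summit.QuantumFields.BalabanUV.Beta.FP.HorizontalRemainderTotal

open Finset Filter Topology
open Literature.MathematicalPhysics.QuantumFieldTheory.Balaban1983to89
open Literature.MathematicalPhysics.QuantumFieldTheory.Balaban1983to89.Beta
open Literature.MathematicalPhysics.QuantumFieldTheory.Balaban1983to89.Beta.DyadicShell (Pt supNorm natAbs_le_supNorm)
open Summit.QuantumFields.BalabanUV.Beta.FP.HorizontalEndNat (hasym_of_horizontal_nat)
open Summit.QuantumFields.BalabanUV.Beta.FP.MixLoopPowerCounting (abs_coord_mul_coord_le)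

/-! ## §1 The one-letter assembly -/

/-- **THE γ-END OF RECORD (GAMMA-8, by type)**: the truncated transport's TOTAL coarse second moment (a) plus ONE uniform bound (rem) on the finite weighted sums
of the remainder `T − Xtr` give `Summable (v ↦ T μ ν v·v_μ·v_ν)` and `|secondMoment T μ ν − gN| ≤ U₀ + Bρ`. [folklore] -/
theorem abs_secondMoment_sub_window_le_of_remainder {T : Fin 4 → Fin 4 → Pt → ℝ} {Xtr : Pt → ℝ} {μ ν : Fin 4} {gN E₀ U₀ Bρ : ℝ}
    (ha : HasSum (fun v : Pt => Xtr v * (v μ : ℝ) * (v ν : ℝ)) (gN + E₀)) (hE₀ : |E₀| ≤ U₀)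
    (hrem : ∀ S : Finset Pt, ∑ v ∈ S, (supNorm v : ℝ) ^ 2 * |T μ ν v - Xtr v| ≤ Bρ) :
    Summable (fun v : Pt => T μ ν v * (v μ : ℝ) * (v ν : ℝ)) ∧ |B12Beta.secondMoment T μ ν - gN| ≤ U₀ + Bρ := by
  set D : Pt → ℝ := fun v => (T μ ν v - Xtr v) * (v μ : ℝ) * (v ν : ℝ) with hD
  -- `|D v| ≤ ‖v‖²·|T − Xtr|`, so the finite sums of `|D|` are uniformly bounded by `Bρ`
  have hDle : ∀ v, |D v| ≤ (supNorm v : ℝ) ^ 2 * |T μ ν v - Xtr v| := by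
    intro v
    simp only [hD]
    rw [mul_assoc, abs_mul, mul_comm]
    exact mul_le_mul_of_nonneg_right (abs_coord_mul_coord_le v μ ν) (abs_nonneg _)
  have hsum : ∀ S : Finset Pt, ∑ v ∈ S, |D v| ≤ Bρ := fun S => (Finset.sum_le_sum fun v _ => hDle v).trans (hrem S)
  have hDabs : Summable fun v => |D v| := summable_of_sum_le (fun _ => abs_nonneg _) hsum
  have hDs : Summable D := hDabs.of_abs
  have hDt : |∑' v, D v| ≤ Bρ := by
    calc |∑' v, D v| ≤ ∑' v, |D v| := by
          have h1 : ∑' v, D v ≤ ∑' v, |D v| := hDs.tsum_le_tsum (fun v => le_abs_self _) hDabs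
          have h2 : -(∑' v, D v) ≤ ∑' v, |D v| := by
            rw [← tsum_neg]; exact hDs.neg.tsum_le_tsum (fun v => neg_le_abs _) hDabs
          exact abs_le.mpr ⟨by linarith, h1⟩
      _ ≤ Bρ := hDabs.tsum_le_of_sum_le hsum
  -- `T·vv = Xtr·vv + D`
  have hsplit : ∀ v : Pt, T μ ν v * (v μ : ℝ) * (v ν : ℝ) = Xtr v * (v μ : ℝ) * (v ν : ℝ) + D v := fun v => by
    simp only [hD]; ring
  have hT : HasSum (fun v : Pt => T μ ν v * (v μ : ℝ) * (v ν : ℝ)) (gN + E₀ + ∑' v, D v) :=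
    (ha.add hDs.hasSum).congr_fun fun v => hsplit v
  refine ⟨hT.summable, ?_⟩
  have hM : B12Beta.secondMoment T μ ν = gN + E₀ + ∑' v, D v := by
    unfold B12Beta.secondMoment; exact hT.tsum_eq
  rw [hM, show gN + E₀ + ∑' v, D v - gN = E₀ + ∑' v, D v by ring]
  exact (abs_add_le _ _).trans (add_le_add hE₀ hDt)

/-! ## §2 From the m-uniform letters to the literal `hbook` and `hasym` -/

/-- **`hbook` UNDER γ, m-UNIFORMLY** (END of record): if at every blocking `N = L^m` (`m ≥ 1`) the two letters hold with constants INDEPENDENT of `m`, then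
`|f m − g(L^m)| ≤ U₀ + Bρ` for every `m ≥ 1`, `f m := secondMoment (T m) μ ν`. [folklore] -/
theorem hbook_of_remainder {T : ℕ → Fin 4 → Fin 4 → Pt → ℝ} {Xtr : ℕ → Pt → ℝ} {g : ℕ → ℝ} {E₀ : ℕ → ℝ} {μ ν : Fin 4} {L : ℕ} {U₀ Bρ : ℝ}
    (ha : ∀ m : ℕ, 1 ≤ m → HasSum (fun v : Pt => Xtr m v * (v μ : ℝ) * (v ν : ℝ)) (g (L ^ m) + E₀ m))
    (hE₀ : ∀ m : ℕ, 1 ≤ m → |E₀ m| ≤ U₀)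
    (hrem : ∀ m : ℕ, 1 ≤ m → ∀ S : Finset Pt, ∑ v ∈ S, (supNorm v : ℝ) ^ 2 * |T m μ ν v - Xtr m v| ≤ Bρ) :
    ∀ m : ℕ, 1 ≤ m → |B12Beta.secondMoment (T m) μ ν - g (L ^ m)| ≤ U₀ + Bρ :=
  fun m hm => (abs_secondMoment_sub_window_le_of_remainder (ha m hm) (hE₀ m hm) (hrem m hm)).2

/-- **`hasym` UNDER γ** (BY NAME `HorizontalEndNat.hasym_of_horizontal_nat`): the m-uniform letters (a), (rem) plus the windowed germ letter
`hgerm : ∀ M ≥ 1, |g M − (s·log M + c₀)| ≤ C` give `|f m − m·(s·log L)| ≤ (U₀ + Bρ) + C + |c₀|` for every `m ≥ 1` (`L ≥ 1`). [folklore] -/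
theorem hasym_of_remainder {T : ℕ → Fin 4 → Fin 4 → Pt → ℝ} {Xtr : ℕ → Pt → ℝ} {g : ℕ → ℝ} {E₀ : ℕ → ℝ} {μ ν : Fin 4} {L : ℕ} {U₀ Bρ s c₀ C : ℝ}
    (hL : 1 ≤ L)
    (ha : ∀ m : ℕ, 1 ≤ m → HasSum (fun v : Pt => Xtr m v * (v μ : ℝ) * (v ν : ℝ)) (g (L ^ m) + E₀ m))
    (hE₀ : ∀ m : ℕ, 1 ≤ m → |E₀ m| ≤ U₀)
    (hrem : ∀ m : ℕ, 1 ≤ m → ∀ S : Finset Pt, ∑ v ∈ S, (supNorm v : ℝ) ^ 2 * |T m μ ν v - Xtr m v| ≤ Bρ)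
    (hgerm : ∀ M : ℕ, 1 ≤ M → |g M - (s * Real.log M + c₀)| ≤ C) :
    ∀ m : ℕ, 1 ≤ m → |B12Beta.secondMoment (T m) μ ν - (m : ℝ) * (s * Real.log L)| ≤ (U₀ + Bρ) + C + |c₀| :=
  hasym_of_horizontal_nat (f := fun m => B12Beta.secondMoment (T m) μ ν) hL (hbook_of_remainder ha hE₀ hrem) hgerm

end Summit.QuantumFields.BalabanUV.Beta.FP.HorizontalRemainderTotal

end
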